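import Summits.CriticalPhenomena.PercolationContinuityZ3.Theorems.PercNearOneGluingNoHeavyLowerTailStarSetSupplyReduction
import HarnessLib

/-!
# `NoHeavyLowerTail` (stmt-CriticalPhenomena-4575) — second-order reduction WITH SURPLUS CREDIT (Step 1' of U1'_r, MWF-CERT §7.2/§7.8)

Support file (prover `prim-gen-swap` gen 9; `--supports stmt-CriticalPhenomena-4575`).  No definitions, no named facts, no sorries.

Sharpening of `StarSet.supply_second_order_reduction`: the credit configurations (`F ∩ S = ∅`, or the first open `F`-class lies in `Ch`)
that carry NO counted chord (`N(S) = 0`) are not consumed by the pointwise inequality; their weight — the SURPLUS credit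
`Σ_S W(S)·1[Y(S) ∧ N(S) = 0]` — can be kept on the left-hand side.  In the U1'_r proof (MWF-CERT §7.8) the defective pairs are paid out
of exactly this surplus by the exchange maps `S ↦ S − κ (− J) (+ A)`.

* `StarSet.supply_reduction_pointwise_surplus`, `StarSet.supply_second_order_reduction_surplus`.
-/

namespace Summit.CriticalPhenomena.PercolationContinuityZ3.Theorems

open Finset
open scoped BigOperators

namespace StarSet

variable {ι : Type*} [Fintype ι] [LinearOrder ι]

/-- **Second-order reduction with surplus, pointwise.**  See the file header. [MWF-CERT.md §7.2 Step 1'] -/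
theorem supply_reduction_pointwise_surplus (adj : ι → ι → Prop) [DecidableRel adj] (Cr F Ch : Finset ι) (S : Finset ι) :
    (∑ κ ∈ Cr, (if (κ ∈ S ∧ ∀ j ∈ univ.filter (fun j => ¬ adj j κ), j ∉ S) then (1 : ℝ) else 0)) +
      (if (((∀ I ∈ F, I ∉ S) ∨ (∃ a ∈ Ch, a ∈ S ∧ ∀ b ∈ F.filter (· < a), b ∉ S)) ∧
          (∀ κ ∈ Cr, ¬ (κ ∈ S ∧ ∀ j ∈ univ.filter (fun j => ¬ adj j κ), j ∉ S))) then (1 : ℝ) else 0) ≤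
      (if (∀ I ∈ F, I ∉ S) then (1 : ℝ) else 0) +
      ∑ a ∈ Ch, (if (a ∈ S ∧ ∀ b ∈ F.filter (· < a), b ∉ S) then (1 : ℝ) else 0) +
      ∑ κ ∈ Cr, ∑ I ∈ (F \ Ch).filter (fun I => adj I κ),
        (if (({κ, I} : Finset ι) ⊆ S ∧ ∀ j ∈ univ.filter (fun j => ¬ adj j κ), j ∉ S) then (1 : ℝ) else 0) +
      ∑ κ ∈ Cr, ∑ κ' ∈ Cr.filter (fun κ' => κ < κ' ∧ adj κ' κ),
        (if (({κ, κ'} : Finset ι) ⊆ S ∧ ∀ j ∈ univ.filter (fun j => ¬ adj j κ), j ∉ S) then (1 : ℝ) else 0) := by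
  have hbase := supply_reduction_pointwise adj Cr F Ch S
  by_cases hsur : ((∀ I ∈ F, I ∉ S) ∨ (∃ a ∈ Ch, a ∈ S ∧ ∀ b ∈ F.filter (· < a), b ∉ S)) ∧
      (∀ κ ∈ Cr, ¬ (κ ∈ S ∧ ∀ j ∈ univ.filter (fun j => ¬ adj j κ), j ∉ S))
  · rw [if_pos hsur]
    -- no counted chord: the left sum vanishes and the credit indicator is available
    have h0 : ∑ κ ∈ Cr, (if (κ ∈ S ∧ ∀ j ∈ univ.filter (fun j => ¬ adj j κ), j ∉ S) then (1 : ℝ) else 0) = 0 :=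
      sum_eq_zero fun κ hκ => if_neg (hsur.2 κ hκ)
    rw [h0, zero_add]
    have h2 : 0 ≤ ∑ κ ∈ Cr, ∑ I ∈ (F \ Ch).filter (fun I => adj I κ),
        (if (({κ, I} : Finset ι) ⊆ S ∧ ∀ j ∈ univ.filter (fun j => ¬ adj j κ), j ∉ S) then (1 : ℝ) else 0) :=
      sum_nonneg fun _ _ => sum_nonneg fun _ _ => by split_ifs <;> norm_num
    have h3 : 0 ≤ ∑ κ ∈ Cr, ∑ κ' ∈ Cr.filter (fun κ' => κ < κ' ∧ adj κ' κ),
        (if (({κ, κ'} : Finset ι) ⊆ S ∧ ∀ j ∈ univ.filter (fun j => ¬ adj j κ), j ∉ S) then (1 : ℝ) else 0) :=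
      sum_nonneg fun _ _ => sum_nonneg fun _ _ => by split_ifs <;> norm_num
    have hcr0 : 0 ≤ (if (∀ I ∈ F, I ∉ S) then (1 : ℝ) else 0) := by split_ifs <;> norm_num
    have hcrA : ∀ a, 0 ≤ (if (a ∈ S ∧ ∀ b ∈ F.filter (· < a), b ∉ S) then (1 : ℝ) else 0) := fun a => by split_ifs <;> norm_num
    have h1 : (1 : ℝ) ≤ (if (∀ I ∈ F, I ∉ S) then (1 : ℝ) else 0) +
        ∑ a ∈ Ch, (if (a ∈ S ∧ ∀ b ∈ F.filter (· < a), b ∉ S) then (1 : ℝ) else 0) := by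
      rcases hsur.1 with h | ⟨a, ha, haS⟩
      · rw [if_pos h]; linarith [sum_nonneg fun a (_ : a ∈ Ch) => hcrA a]
      · have hone : (if (a ∈ S ∧ ∀ b ∈ F.filter (· < a), b ∉ S) then (1 : ℝ) else 0) = 1 := if_pos haS
        have : (1 : ℝ) ≤ ∑ a ∈ Ch, (if (a ∈ S ∧ ∀ b ∈ F.filter (· < a), b ∉ S) then (1 : ℝ) else 0) :=
          le_trans (le_of_eq hone.symm)
            (single_le_sum (f := fun a => if (a ∈ S ∧ ∀ b ∈ F.filter (· < a), b ∉ S) then (1 : ℝ) else 0) (fun a _ => hcrA a) ha)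
        linarith
    linarith
  · rw [if_neg hsur, add_zero]; exact hbase

/-- **Second-order reduction with surplus credit** (integrated form).  See the file header. [MWF-CERT.md §7.2 Step 1'] -/
theorem supply_second_order_reduction_surplus (θ : ι → ℝ) (hθ0 : ∀ i, 0 ≤ θ i) (hθ1 : ∀ i, θ i ≤ 1)
    (adj : ι → ι → Prop) [DecidableRel adj] (Cr F Ch : Finset ι) (hCF : Disjoint Cr F) (hrefl : ∀ κ ∈ Cr, adj κ κ) :
    ∑ κ ∈ Cr, θ κ * ∏ j ∈ univ.filter (fun j => ¬ adj j κ), (1 - θ j) +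
      ∑ S ∈ (univ : Finset ι).powerset, ((∏ k ∈ S, θ k) * ∏ k ∈ univ \ S, (1 - θ k)) *
        (if (((∀ I ∈ F, I ∉ S) ∨ (∃ a ∈ Ch, a ∈ S ∧ ∀ b ∈ F.filter (· < a), b ∉ S)) ∧
            (∀ κ ∈ Cr, ¬ (κ ∈ S ∧ ∀ j ∈ univ.filter (fun j => ¬ adj j κ), j ∉ S))) then (1 : ℝ) else 0) ≤
      (∏ I ∈ F, (1 - θ I) + ∑ a ∈ Ch, θ a * ∏ b ∈ F.filter (· < a), (1 - θ b)) +
      ∑ κ ∈ Cr, (θ κ * ∏ j ∈ univ.filter (fun j => ¬ adj j κ), (1 - θ j)) *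
        (∑ I ∈ (F \ Ch).filter (fun I => adj I κ), θ I + ∑ κ' ∈ Cr.filter (fun κ' => κ < κ' ∧ adj κ' κ), θ κ') := by
  set W : Finset ι → ℝ := fun S => (∏ k ∈ S, θ k) * ∏ k ∈ univ \ S, (1 - θ k) with hW
  have hWnn : ∀ S, 0 ≤ W S := fun S => patternWeight_nonneg θ hθ0 hθ1 S
  set PS := (univ : Finset ι).powerset with hPS
  -- the surplus-free statement, and the pointwise difference
  have hold := supply_second_order_reduction θ hθ0 hθ1 adj Cr F Ch hCF hrefl
  -- integrate the sharper pointwise inequality: it differs from the old one exactly by the surplus term on the left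
  have hpt : ∀ S ∈ PS, W S * ((∑ κ ∈ Cr, (if (κ ∈ S ∧ ∀ j ∈ univ.filter (fun j => ¬ adj j κ), j ∉ S) then (1 : ℝ) else 0)) +
      (if (((∀ I ∈ F, I ∉ S) ∨ (∃ a ∈ Ch, a ∈ S ∧ ∀ b ∈ F.filter (· < a), b ∉ S)) ∧
          (∀ κ ∈ Cr, ¬ (κ ∈ S ∧ ∀ j ∈ univ.filter (fun j => ¬ adj j κ), j ∉ S))) then (1 : ℝ) else 0)) ≤
      W S * ((if (∀ I ∈ F, I ∉ S) then (1 : ℝ) else 0) +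
      ∑ a ∈ Ch, (if (a ∈ S ∧ ∀ b ∈ F.filter (· < a), b ∉ S) then (1 : ℝ) else 0) +
      ∑ κ ∈ Cr, ∑ I ∈ (F \ Ch).filter (fun I => adj I κ),
        (if (({κ, I} : Finset ι) ⊆ S ∧ ∀ j ∈ univ.filter (fun j => ¬ adj j κ), j ∉ S) then (1 : ℝ) else 0) +
      ∑ κ ∈ Cr, ∑ κ' ∈ Cr.filter (fun κ' => κ < κ' ∧ adj κ' κ),
        (if (({κ, κ'} : Finset ι) ⊆ S ∧ ∀ j ∈ univ.filter (fun j => ¬ adj j κ), j ∉ S) then (1 : ℝ) else 0)) :=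
    fun S _ => mul_le_mul_of_nonneg_left (supply_reduction_pointwise_surplus adj Cr F Ch S) (hWnn S)
  have hint := sum_le_sum hpt
  -- the right-hand side integrates as in `supply_second_order_reduction`; we reuse its proof through the old inequality:
  -- LHS_old(S) ≤ RHS(S) pointwise and Σ W·RHS = closed form; here we only need Σ W·(LHS_old + surplus) ≤ Σ W·RHS = closed form.
  -- Evaluate Σ_S W(S)·LHS_old(S) = Σ_κ θ_κ Π_far (cylinder sums) and keep the surplus as is.
  set far : ι → Finset ι := fun κ => univ.filter (fun j => ¬ adj j κ) with hfar
  have hκfar : ∀ κ ∈ Cr, κ ∉ far κ := fun κ hκ h => (mem_filter.1 h).2 (hrefl κ hκ)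
  have hL : ∑ S ∈ PS, W S * ∑ κ ∈ Cr, (if (κ ∈ S ∧ ∀ j ∈ univ.filter (fun j => ¬ adj j κ), j ∉ S) then (1 : ℝ) else 0) =
      ∑ κ ∈ Cr, θ κ * ∏ j ∈ far κ, (1 - θ j) := by
    rw [show (∑ S ∈ PS, W S * ∑ κ ∈ Cr, (if (κ ∈ S ∧ ∀ j ∈ univ.filter (fun j => ¬ adj j κ), j ∉ S) then (1 : ℝ) else 0)) =
        ∑ κ ∈ Cr, ∑ S ∈ PS, W S * (if (κ ∈ S ∧ ∀ j ∈ far κ, j ∉ S) then (1 : ℝ) else 0) by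
      rw [sum_comm]; exact sum_congr rfl fun S _ => by rw [mul_sum]]
    exact sum_congr rfl fun κ hκ => cylinder_sum_one_open θ κ (far κ) (hκfar κ hκ)
  -- the integrated right-hand side is bounded by the closed form: this is literally the content of the old theorem's proof,
  -- which we recover by comparing with `hold` through the old pointwise identity.  We redo the (short) evaluation instead.
  have hR0 : ∑ S ∈ PS, W S * (if (∀ I ∈ F, I ∉ S) then (1 : ℝ) else 0) = ∏ I ∈ F, (1 - θ I) := cylinder_sum_closed θ F
  have hRA : ∑ S ∈ PS, W S * ∑ a ∈ Ch, (if (a ∈ S ∧ ∀ b ∈ F.filter (· < a), b ∉ S) then (1 : ℝ) else 0) =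
      ∑ a ∈ Ch, θ a * ∏ b ∈ F.filter (· < a), (1 - θ b) := by
    rw [show (∑ S ∈ PS, W S * ∑ a ∈ Ch, (if (a ∈ S ∧ ∀ b ∈ F.filter (· < a), b ∉ S) then (1 : ℝ) else 0)) =
        ∑ a ∈ Ch, ∑ S ∈ PS, W S * (if (a ∈ S ∧ ∀ b ∈ F.filter (· < a), b ∉ S) then (1 : ℝ) else 0) by
      rw [sum_comm]; exact sum_congr rfl fun S _ => by rw [mul_sum]]
    exact sum_congr rfl fun a _ => cylinder_sum_one_open θ a (F.filter (· < a)) (by simp)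
  have hpair : ∀ κ ∈ Cr, ∀ x, adj x κ → x ≠ κ →
      ∑ S ∈ PS, W S * (if (({κ, x} : Finset ι) ⊆ S ∧ ∀ j ∈ univ.filter (fun j => ¬ adj j κ), j ∉ S) then (1 : ℝ) else 0) =
        θ κ * θ x * ∏ j ∈ far κ, (1 - θ j) := by
    intro κ hκ x hx hxκ
    have hdisj : Disjoint ({κ, x} : Finset ι) (far κ) := by
      rw [disjoint_insert_left, disjoint_singleton_left]
      exact ⟨hκfar κ hκ, fun h => (mem_filter.1 h).2 hx⟩
    rw [cylinder_sum θ {κ, x} (far κ) hdisj, prod_pair hxκ.symm]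
  have hswap : ∀ (T : ι → Finset ι) (f : ι → ι → Finset ι → ℝ),
      ∑ S ∈ PS, W S * ∑ κ ∈ Cr, ∑ I ∈ T κ, f κ I S = ∑ κ ∈ Cr, ∑ I ∈ T κ, ∑ S ∈ PS, W S * f κ I S := by
    intro T f
    calc ∑ S ∈ PS, W S * ∑ κ ∈ Cr, ∑ I ∈ T κ, f κ I S
        = ∑ S ∈ PS, ∑ κ ∈ Cr, ∑ I ∈ T κ, W S * f κ I S := by
          refine sum_congr rfl fun S _ => ?_
          rw [mul_sum]
          exact sum_congr rfl fun κ _ => by rw [mul_sum]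
      _ = ∑ κ ∈ Cr, ∑ S ∈ PS, ∑ I ∈ T κ, W S * f κ I S := sum_comm
      _ = ∑ κ ∈ Cr, ∑ I ∈ T κ, ∑ S ∈ PS, W S * f κ I S := sum_congr rfl fun κ _ => sum_comm
  have hR2 : ∑ S ∈ PS, W S * ∑ κ ∈ Cr, ∑ I ∈ (F \ Ch).filter (fun I => adj I κ),
      (if (({κ, I} : Finset ι) ⊆ S ∧ ∀ j ∈ univ.filter (fun j => ¬ adj j κ), j ∉ S) then (1 : ℝ) else 0) =
      ∑ κ ∈ Cr, ∑ I ∈ (F \ Ch).filter (fun I => adj I κ), θ κ * θ I * ∏ j ∈ far κ, (1 - θ j) := by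
    rw [hswap (fun κ => (F \ Ch).filter (fun I => adj I κ))
      (fun κ I S => if (({κ, I} : Finset ι) ⊆ S ∧ ∀ j ∈ univ.filter (fun j => ¬ adj j κ), j ∉ S) then (1 : ℝ) else 0)]
    refine sum_congr rfl fun κ hκ => sum_congr rfl fun I hI => ?_
    have hI' := mem_filter.1 hI
    exact hpair κ hκ I hI'.2 (fun h => disjoint_left.1 hCF hκ (h ▸ (mem_sdiff.1 hI'.1).1))
  have hR3 : ∑ S ∈ PS, W S * ∑ κ ∈ Cr, ∑ κ' ∈ Cr.filter (fun κ' => κ < κ' ∧ adj κ' κ),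
      (if (({κ, κ'} : Finset ι) ⊆ S ∧ ∀ j ∈ univ.filter (fun j => ¬ adj j κ), j ∉ S) then (1 : ℝ) else 0) =
      ∑ κ ∈ Cr, ∑ κ' ∈ Cr.filter (fun κ' => κ < κ' ∧ adj κ' κ), θ κ * θ κ' * ∏ j ∈ far κ, (1 - θ j) := by
    rw [hswap (fun κ => Cr.filter (fun κ' => κ < κ' ∧ adj κ' κ))
      (fun κ κ' S => if (({κ, κ'} : Finset ι) ⊆ S ∧ ∀ j ∈ univ.filter (fun j => ¬ adj j κ), j ∉ S) then (1 : ℝ) else 0)]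
    refine sum_congr rfl fun κ hκ => sum_congr rfl fun κ' hκ' => ?_
    have h' := (mem_filter.1 hκ').2
    exact hpair κ hκ κ' h'.2 (ne_of_gt h'.1)
  -- assemble
  have hlhs : ∑ S ∈ PS, W S * ((∑ κ ∈ Cr, (if (κ ∈ S ∧ ∀ j ∈ univ.filter (fun j => ¬ adj j κ), j ∉ S) then (1 : ℝ) else 0)) +
      (if (((∀ I ∈ F, I ∉ S) ∨ (∃ a ∈ Ch, a ∈ S ∧ ∀ b ∈ F.filter (· < a), b ∉ S)) ∧
          (∀ κ ∈ Cr, ¬ (κ ∈ S ∧ ∀ j ∈ univ.filter (fun j => ¬ adj j κ), j ∉ S))) then (1 : ℝ) else 0)) =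
      ∑ κ ∈ Cr, θ κ * ∏ j ∈ univ.filter (fun j => ¬ adj j κ), (1 - θ j) +
      ∑ S ∈ PS, W S * (if (((∀ I ∈ F, I ∉ S) ∨ (∃ a ∈ Ch, a ∈ S ∧ ∀ b ∈ F.filter (· < a), b ∉ S)) ∧
          (∀ κ ∈ Cr, ¬ (κ ∈ S ∧ ∀ j ∈ univ.filter (fun j => ¬ adj j κ), j ∉ S))) then (1 : ℝ) else 0) := by
    rw [← hL, ← sum_add_distrib]
    exact sum_congr rfl fun S _ => by ring
  have hrhs : ∑ S ∈ PS, W S * ((if (∀ I ∈ F, I ∉ S) then (1 : ℝ) else 0) +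
      ∑ a ∈ Ch, (if (a ∈ S ∧ ∀ b ∈ F.filter (· < a), b ∉ S) then (1 : ℝ) else 0) +
      ∑ κ ∈ Cr, ∑ I ∈ (F \ Ch).filter (fun I => adj I κ),
        (if (({κ, I} : Finset ι) ⊆ S ∧ ∀ j ∈ univ.filter (fun j => ¬ adj j κ), j ∉ S) then (1 : ℝ) else 0) +
      ∑ κ ∈ Cr, ∑ κ' ∈ Cr.filter (fun κ' => κ < κ' ∧ adj κ' κ),
        (if (({κ, κ'} : Finset ι) ⊆ S ∧ ∀ j ∈ univ.filter (fun j => ¬ adj j κ), j ∉ S) then (1 : ℝ) else 0)) =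
      (∏ I ∈ F, (1 - θ I) + ∑ a ∈ Ch, θ a * ∏ b ∈ F.filter (· < a), (1 - θ b)) +
      ∑ κ ∈ Cr, (θ κ * ∏ j ∈ univ.filter (fun j => ¬ adj j κ), (1 - θ j)) *
        (∑ I ∈ (F \ Ch).filter (fun I => adj I κ), θ I + ∑ κ' ∈ Cr.filter (fun κ' => κ < κ' ∧ adj κ' κ), θ κ') := by
    have hsplit : ∀ S ∈ PS, W S * ((if (∀ I ∈ F, I ∉ S) then (1 : ℝ) else 0) +
        ∑ a ∈ Ch, (if (a ∈ S ∧ ∀ b ∈ F.filter (· < a), b ∉ S) then (1 : ℝ) else 0) +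
        ∑ κ ∈ Cr, ∑ I ∈ (F \ Ch).filter (fun I => adj I κ),
          (if (({κ, I} : Finset ι) ⊆ S ∧ ∀ j ∈ univ.filter (fun j => ¬ adj j κ), j ∉ S) then (1 : ℝ) else 0) +
        ∑ κ ∈ Cr, ∑ κ' ∈ Cr.filter (fun κ' => κ < κ' ∧ adj κ' κ),
          (if (({κ, κ'} : Finset ι) ⊆ S ∧ ∀ j ∈ univ.filter (fun j => ¬ adj j κ), j ∉ S) then (1 : ℝ) else 0)) =
        W S * (if (∀ I ∈ F, I ∉ S) then (1 : ℝ) else 0) +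
        W S * ∑ a ∈ Ch, (if (a ∈ S ∧ ∀ b ∈ F.filter (· < a), b ∉ S) then (1 : ℝ) else 0) +
        W S * ∑ κ ∈ Cr, ∑ I ∈ (F \ Ch).filter (fun I => adj I κ),
          (if (({κ, I} : Finset ι) ⊆ S ∧ ∀ j ∈ univ.filter (fun j => ¬ adj j κ), j ∉ S) then (1 : ℝ) else 0) +
        W S * ∑ κ ∈ Cr, ∑ κ' ∈ Cr.filter (fun κ' => κ < κ' ∧ adj κ' κ),
          (if (({κ, κ'} : Finset ι) ⊆ S ∧ ∀ j ∈ univ.filter (fun j => ¬ adj j κ), j ∉ S) then (1 : ℝ) else 0) := by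
      intro S _; ring
    rw [sum_congr rfl hsplit, sum_add_distrib, sum_add_distrib, sum_add_distrib, hR0, hRA, hR2, hR3]
    have hκ : ∀ κ ∈ Cr, (∑ I ∈ (F \ Ch).filter (fun I => adj I κ), θ κ * θ I * ∏ j ∈ far κ, (1 - θ j)) +
        ∑ κ' ∈ Cr.filter (fun κ' => κ < κ' ∧ adj κ' κ), θ κ * θ κ' * ∏ j ∈ far κ, (1 - θ j) =
        (θ κ * ∏ j ∈ univ.filter (fun j => ¬ adj j κ), (1 - θ j)) *
          (∑ I ∈ (F \ Ch).filter (fun I => adj I κ), θ I + ∑ κ' ∈ Cr.filter (fun κ' => κ < κ' ∧ adj κ' κ), θ κ') := by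
      intro κ _
      rw [mul_add, mul_sum, mul_sum]
      congr 1
      · exact sum_congr rfl fun I _ => by ring
      · exact sum_congr rfl fun κ' _ => by ring
    rw [add_assoc, ← sum_add_distrib, sum_congr rfl hκ]
  rw [hlhs, hrhs] at hint
  exact hint

end StarSet

end Summit.CriticalPhenomena.PercolationContinuityZ3.Theorems
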